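import Literature.AnabelianGeometry.AbsoluteAnabelian.LogShellVolumes
import Literature.AnabelianGeometry.AbsoluteAnabelian.LocalVolumesNonarchimedeanProofs
import Literature.AnabelianGeometry.AbsoluteAnabelian.LocalVolumesArchimedeanProofs
import Literature.IUT.LogThetaLattice.HolomorphicLogShellsProofs
import HarnessLib

/-!
# [AbsTopIII] Corollary 5.10 (ii) "Log-Frobenius Compatibility of Log-volumes" AT THE GENUINE FAMILY OF
# COMPLETIONS (D-0079 L-F sub-cell [AbsTop*]+[AbsAnab], `plan/L4/LF-ABSTOP.tsv` row F-0161
# `LogVolumesLogCompatible`; seat abc-iut-w5-d246; proof-only bridging file, 0 `def`)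

S. Mochizuki, *Topics in absolute anabelian geometry III: global reconstruction algorithms*, J. Math. Sci.
Univ. Tokyo **22** (2015) 939–1156, Cor. 5.10 (ii) p. 147 of the author's manuscript
[cite: MochizukiAbsTopIII2015, Cor 5.10 (ii) p. 147]:

> "(ii) (Log-Frobenius Compatibility of Log-volumes) … the log-volume (resp. radial log-volume) computed at
> `⋎ ∈ L` is compatible [cf. Proposition 5.7, (i), (c); (ii), (c)], relative to the relevant log-homotopy,
> with the log-volume (resp. angular log-volume) computed at `⋎ + 1 ∈ L`."

The row's declaration (abc-iut-L4-t3, `LogShellVolumes.lean`, DEFS-FROZEN) is the SCHEMA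
`LogVolumesLogCompatible K log hasArc := (∀ v, LogVolumeCompatible (log v)) ∧ (hasArc → ExpLogVolumeCompatible)`
over a FREE family of maps `log v : K v → K v`; its universal closure is false (a free `log` need not preserve
log-volumes: `exists_not_logVolumeCompatible`, `not_forall_logVolumeCompatible`, `LogShellVolumesSchemaNegative.lean`).
What print asserts is the instance at THE logarithms of the completions: at every nonarchimedean place the
`p_v`-adic logarithm `log_{k_v}` (abc-iut-S1's `Literature.IUT.LogVolume.unitLog` on a `p_v`-adic field, extended by
junk values off the units) and at the archimedean places the exponential of `ℂ`.  Both conjuncts are ALREADY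
theorems of the cell: `logVolumeCompatible_unitLog` (`LocalVolumesNonarchimedeanProofs.lean`: Prop. 5.7 (i)(c) for
`log_p`, from abc-iut-L3-t11's `isIsometricOnSmallBalls_unitLog` and abc-iut-S2's
`LogVolumeCompatibleOfIsometric_holds`) and `ComplexVolume.ExpLogVolumeCompatible_holds`
(`LocalVolumesArchimedeanProofs.lean`: Prop. 5.7 (ii)(c)).  This file records the CONJUNCTION with the row's
declaration as conclusion head, for EVERY family of genuine completions (any index types, any residue
characteristics `p_v`, with or without archimedean places), and its twin at the standard-model structure
`PadicLogOnUnits.ofUnitLog p_v (K v)` of `LogShellsOfUnitLog.lean` (whose `log` field IS `unitLog`;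
abc-iut-L6-d2's `logVolumeCompatible_ofUnitLog`).  No hypothesis beyond "the `K v` are `p_v`-adic fields".

Honest framing: a FACT row is an assumption label on OUR typed statement of a refereed 2015 result; PROVED =
OUR kernel check of OUR typed instance form; nothing here bears on, or takes a side on, [IUTchIII] Cor. 3.12.
-/

set_option autoImplicit false

noncomputable section

namespace Literature.IUT.LogThetaLattice

open Literature.AnabelianGeometry.AbsoluteAnabelian

/-- **[AbsTopIII] Cor. 5.10 (ii) at THE genuine family of completions** (row F-0161): for every family
`K v` (`v ∈ V^non`) of `p_v`-adic fields — complete nonarchimedean fields that are normed `ℚ_{p_v}`-algebras,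
locally compact — the log-volumes are compatible with the `p_v`-adic logarithms `log_{k_v}` at every
nonarchimedean place (Prop. 5.7 (i)(c)) and, when there are archimedean places, the radial/angular log-volumes of
`ℂ` are compatible with the exponential (Prop. 5.7 (ii)(c)).  Conjunction of `logVolumeCompatible_unitLog` and
`ComplexVolume.ExpLogVolumeCompatible_holds`, no further hypothesis. [cite: MochizukiAbsTopIII2015, Cor 5.10 (ii) p. 147] -/
theorem logVolumesLogCompatible_unitLog {Vnon : Type} (p : Vnon → ℕ) [∀ v, Fact (p v).Prime]
    (K : Vnon → Type) [∀ v, NontriviallyNormedField (K v)] [∀ v, NormedAlgebra ℚ_[p v] (K v)]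
    [∀ v, IsUltrametricDist (K v)] [∀ v, ProperSpace (K v)] [∀ v, MeasurableSpace (K v)]
    [∀ v, BorelSpace (K v)] (hasArc : Prop) :
    Literature.AnabelianGeometry.AbsoluteAnabelian.LogVolumesLogCompatible K
      (fun v => (Literature.IUT.LogVolume.unitLog : K v → K v)) hasArc :=
  ⟨fun v => logVolumeCompatible_unitLog (p v), fun _ => ComplexVolume.ExpLogVolumeCompatible_holds⟩

/-- **[AbsTopIII] Cor. 5.10 (ii) at THE standard-model structures `PadicLogOnUnits.ofUnitLog p_v (K v)`**
(row F-0161, the form the log-shell rows F-0160/F-0162/F-0163 are instanced at): the family of their `log` fields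
— which are the `p_v`-adic logarithms — is log-volume compatible at every place (abc-iut-L6-d2's
`logVolumeCompatible_ofUnitLog` at each `v`, and `ComplexVolume.ExpLogVolumeCompatible_holds`).
[cite: MochizukiAbsTopIII2015, Cor 5.10 (ii) p. 147] -/
theorem logVolumesLogCompatible_ofUnitLog {Vnon : Type} (p : Vnon → ℕ) [∀ v, Fact (p v).Prime]
    (K : Vnon → Type) [∀ v, NontriviallyNormedField (K v)] [∀ v, NormedAlgebra ℚ_[p v] (K v)]
    [∀ v, IsUltrametricDist (K v)] [∀ v, ProperSpace (K v)] [∀ v, MeasurableSpace (K v)]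
    [∀ v, BorelSpace (K v)] (hasArc : Prop) :
    Literature.AnabelianGeometry.AbsoluteAnabelian.LogVolumesLogCompatible K
      (fun v => (PadicLogOnUnits.ofUnitLog (p v) (K v)).log) hasArc :=
  ⟨fun v => logVolumeCompatible_ofUnitLog (p v) (K v), fun _ => ComplexVolume.ExpLogVolumeCompatible_holds⟩

/-- **The single-place case** (one nonarchimedean completion `K`, archimedean places present or not), the
shape a consumer working one prime at a time instantiates: Cor. 5.10 (ii) for the one-member family.
[cite: MochizukiAbsTopIII2015, Cor 5.10 (ii) p. 147] -/
theorem logVolumesLogCompatible_unitLog_single (p : ℕ) [Fact p.Prime] (K : Type) [NontriviallyNormedField K]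
    [NormedAlgebra ℚ_[p] K] [IsUltrametricDist K] [ProperSpace K] [MeasurableSpace K] [BorelSpace K]
    (hasArc : Prop) :
    Literature.AnabelianGeometry.AbsoluteAnabelian.LogVolumesLogCompatible (fun _ : PUnit => K)
      (fun _ => (Literature.IUT.LogVolume.unitLog : K → K)) hasArc :=
  logVolumesLogCompatible_unitLog (fun _ => p) (fun _ : PUnit => K) hasArc

end Literature.IUT.LogThetaLattice

end
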